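import Mathlib
import Summits.NavierStokesRegularity.NavierStokesRegularity.Theorems.SlicedKelvinPlanarFluxAPrioriDecayDuhamelWeighted
import Summits.NavierStokesRegularity.NavierStokesRegularity.Theorems.SlicedKelvinPlanarFluxAPrioriDecayHeatWeight

/-!
# Crux `SlicedKelvin.PlanarFluxAPriori` (stmt-NavierStokesRegularity-15600), line `registered`,
# stub `stub_decayPersistence` — the one-step inequality of the weighted Gronwall argument

Support file (theorems only) for the weighted bootstrap of the decay-persistence stub
(Brandolese 2004; Kukavica–Torres 2006). A bounded field `g` on `[0, T₁] × ℝ³` represented for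
`0 < τ ≤ T₁` as `g(τ) = e^{ντΔ} g(0) - Σᵢ B^ν_0(aᵢ, bᵢ)(τ)` by finitely many Duhamel terms of
bounded fields, each pair containing `g` or a field of known cubic decay, has truncated weighted
suprema `Φ(t) = sup_{τ ≤ t, y} w_R(y)|g(τ,y)|` obeying, for every step `δ > 0`,

  `Φ(t) ≤ α + n C₀ C_K L (2ν^{-1/2}√δ + δ) Φ(t) + n C₀ C_K L ((νδ)^{-1/2} + 1) T₁ Φ(max(t-δ,0))`

(`decay_bootstrap_step`: caloric term by `decay_weighted_heatExtension_le`, each Duhamel term by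
`decay_weighted_oseenDuhamel_le` with the monotone majorant `σ ↦ Φ(clamp σ)` or the constant
majorant of the known terms).

## References

* L. Brandolese, *Space-time decay of Navier–Stokes flows invariant under rotations*,
  Math. Ann. 329 (2004) = arXiv:math/0403136.
* I. Kukavica, J. J. Torres, *Weighted bounds for the velocity and the vorticity for the
  Navier–Stokes equations*, Nonlinearity 19 (2006).
* G. Koch, N. Nadirashvili, G. Seregin, V. Šverák, Acta Math. 203 (2009), §3 (3.8), §4.
-/

noncomputable section

-- the summit and its single sub-problem share the name (CONVENTIONS §1), as in every Theorems file
set_option linter.dupNamespace false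

namespace Summit.NavierStokesRegularity.NavierStokesRegularity.Theorems.SlicedKelvinPlanarFluxAPriori

open MeasureTheory Set Filter Topology Metric Real
open scoped ENNReal NNReal
open Literature.Analysis.FluidPDE Literature.Analysis.UnboundedOperators

/-! ### The bootstrap -/

/-- **The one-step inequality of the weighted Gronwall argument.** In the setting of
`decay_weighted_bootstrap` (representation of `g` by `e^{ντΔ}g(0)` and at most `n` Duhamel terms,
bounds `L`, `A₀`, `A₁`), fix `R ≥ 1` and let `Φ(t)` be the supremum of `w_R(y) |g(τ, y)|` over
`τ ∈ [0, t]`, `y ∈ ℝ³` (abstractly: any function with the four listed sup-properties). Then for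
every step `δ > 0` and every `t ∈ [0, T₁]`,
`Φ(t) ≤ α + n C₀ C_K L (2ν^{-1/2}√δ + δ) Φ(t) + n C₀ C_K L ((νδ)^{-1/2} + 1) T₁ Φ(max(t-δ, 0))`
with `α = A₀ + C_G (1 + (νT₁)^{3/2}) A₀ + n C₀ C_K L A₁ (2ν^{-1/2}√T₁ + T₁ + ((νT₁)^{-1/2}+1)T₁)`
(caloric term: `decay_weighted_heatExtension_le`; each Duhamel term:
`decay_weighted_oseenDuhamel_le` with the monotone majorant `σ ↦ Φ(clamp σ)` or the constant
`A₁`). -/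
theorem decay_bootstrap_step :
    ∀ {C₀ C_K C_G : ℝ} (hC₀ : 0 < C₀) (hC_K : 0 < C_K) (hC_G : 0 < C_G)
    (hK : ∀ ⦃σ : ℝ⦄, 0 < σ → ∀ z a b : EuclideanSpace ℝ (Fin 3),
      ‖Literature.Analysis.FluidPDE.oseenKernel σ z a b‖ ≤ C₀ * (σ + ‖z‖ ^ 2) ^ (-(2 : ℝ)) * ‖a‖ * ‖b‖)
    (hW : ∀ ⦃R : ℝ⦄, 1 ≤ R → ∀ ⦃s : ℝ⦄, 0 < s → ∀ x : EuclideanSpace ℝ (Fin 3),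
      ∫⁻ y, ENNReal.ofReal ((s + ‖x - y‖ ^ 2) ^ (-(2 : ℝ)) *
          ((min (1 + ‖x‖) R) ^ 3 / (min (1 + ‖y‖) R) ^ 3)) ≤
        ENNReal.ofReal (C_K * (s ^ (-(1 / 2 : ℝ)) + 1)))
    (hG : ∀ ⦃s : ℝ⦄, 0 < s → ∀ {f : EuclideanSpace ℝ (Fin 3) → EuclideanSpace ℝ (Fin 3)},
      Continuous f → ∀ {A : ℝ}, (∀ y, (1 + ‖y‖) ^ 3 * ‖f y‖ ≤ A) → ∀ x : EuclideanSpace ℝ (Fin 3),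
        (1 + ‖x‖) ^ 3 * ‖Literature.Analysis.UnboundedOperators.heatExtension f s x‖ ≤
          C_G * (1 + s ^ (3 / 2 : ℝ)) * A)
    {ν T₁ L A₀ A₁ : ℝ} {n : ℕ} (hν : 0 < ν) (hT₁ : 0 < T₁) (hL : 0 ≤ L) (hA₀ : 0 ≤ A₀)
    (hA₁ : 0 ≤ A₁) {ι : Type} [Fintype ι]
    {g : ℝ → EuclideanSpace ℝ (Fin 3) → EuclideanSpace ℝ (Fin 3)}
    {a b : ι → ℝ → EuclideanSpace ℝ (Fin 3) → EuclideanSpace ℝ (Fin 3)}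
    (hcard : Fintype.card ι ≤ n) (hg0c : Continuous (g 0))
    (hg0 : ∀ x, (1 + ‖x‖) ^ 3 * ‖g 0 x‖ ≤ A₀)
    (hlist : ∀ i, (∀ τ ∈ Set.Icc 0 T₁, ∀ y, ‖a i τ y‖ ≤ L ∧ ‖b i τ y‖ ≤ L) ∧
      (a i = g ∨ b i = g ∨ (∀ τ ∈ Set.Icc 0 T₁, ∀ y, (1 + ‖y‖) ^ 3 * ‖a i τ y‖ ≤ A₁) ∨
        (∀ τ ∈ Set.Icc 0 T₁, ∀ y, (1 + ‖y‖) ^ 3 * ‖b i τ y‖ ≤ A₁)))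
    (hrep : ∀ τ ∈ Set.Ioc 0 T₁, ∀ x, g τ x =
      Literature.Analysis.UnboundedOperators.heatExtension (g 0) (ν * τ) x -
        ∑ i, Literature.Analysis.FluidPDE.oseenDuhamel ν 0 (a i) (b i) τ x)
    {R : ℝ} (hR : 1 ≤ R) (Φ : ℝ → ℝ)
    (hΦ1 : ∀ {t : ℝ}, t ≤ T₁ → ∀ τ ∈ Set.Icc 0 t, ∀ y, (min (1 + ‖y‖) R) ^ 3 * ‖g τ y‖ ≤ Φ t)
    (hΦ2 : ∀ {t : ℝ}, 0 ≤ t → ∀ {M : ℝ},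
      (∀ τ ∈ Set.Icc 0 t, ∀ y, (min (1 + ‖y‖) R) ^ 3 * ‖g τ y‖ ≤ M) → Φ t ≤ M)
    (hΦ3 : ∀ {t : ℝ}, 0 ≤ t → t ≤ T₁ → 0 ≤ Φ t)
    (hΦ4 : ∀ {t t' : ℝ}, 0 ≤ t → t ≤ t' → t' ≤ T₁ → Φ t ≤ Φ t')
    {δ : ℝ} (hδ : 0 < δ) {t : ℝ} (ht : t ∈ Set.Icc 0 T₁),
    Φ t ≤ (A₀ + C_G * (1 + (ν * T₁) ^ (3 / 2 : ℝ)) * A₀ +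
        n * (C₀ * C_K * L) * A₁ * ((2 * ν ^ (-(1 / 2 : ℝ)) * Real.sqrt T₁ + T₁) +
          ((ν * T₁) ^ (-(1 / 2 : ℝ)) + 1) * T₁)) +
      n * (C₀ * C_K * L) * (2 * ν ^ (-(1 / 2 : ℝ)) * Real.sqrt δ + δ) * Φ t +
      n * (C₀ * C_K * L) * (((ν * δ) ^ (-(1 / 2 : ℝ)) + 1) * T₁) * Φ (max (t - δ) 0) := by
  intro C₀ C_K C_G hC₀ hC_K hC_G hK hW hG ν T₁ L A₀ A₁ n hν hT₁ hL hA₀ hA₁ ι _ g a b hcard hg0c hg0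
    hlist hrep R hR Φ hΦ1 hΦ2 hΦ3 hΦ4 δ hδ t ht
  -- abbreviations
  have hν12 : 0 < ν ^ (-(1 / 2 : ℝ)) := Real.rpow_pos_of_pos hν _
  set I : ℝ := 2 * ν ^ (-(1 / 2 : ℝ)) * Real.sqrt δ + δ with hI
  set J : ℝ := (ν * δ) ^ (-(1 / 2 : ℝ)) + 1 with hJ
  set I₁ : ℝ := 2 * ν ^ (-(1 / 2 : ℝ)) * Real.sqrt T₁ + T₁ with hI₁
  set J₁ : ℝ := (ν * T₁) ^ (-(1 / 2 : ℝ)) + 1 with hJ₁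
  have hI0 : 0 ≤ I := by positivity
  have hJ0 : 0 ≤ J := by positivity
  have hI₁0 : 0 ≤ I₁ := by positivity
  have hJ₁0 : 0 ≤ J₁ := by positivity
  clear_value I J I₁ J₁
  set td : ℝ := max (t - δ) 0 with htd
  have htd0 : 0 ≤ td := le_max_right _ _
  have htdT : td ≤ T₁ := max_le (by linarith [ht.2]) hT₁.le
  clear_value td
  have hCL : 0 ≤ C₀ * C_K * L := by positivity
  have hΦt0 : 0 ≤ Φ t := hΦ3 ht.1 ht.2
  have hΦd0 : 0 ≤ Φ td := hΦ3 htd0 htdT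
  -- the monotone majorant `φ σ = Φ (clamp σ to [0, T₁])`
  set φ : ℝ → ℝ := fun σ => Φ (min (max σ 0) T₁) with hφ
  have hφ0 : ∀ σ, 0 ≤ φ σ := fun σ => hΦ3 (le_min (le_max_right _ _) hT₁.le) (min_le_right _ _)
  have hφm : Monotone φ := by
    intro σ σ' hσσ'
    exact hΦ4 (le_min (le_max_right _ _) hT₁.le) (min_le_min_right _ (max_le_max_right _ hσσ'))
      (min_le_right _ _)
  have hφt : φ t = Φ t := by
    rw [hφ]; dsimp only; rw [max_eq_left ht.1, min_eq_left ht.2]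
  have hφtd : φ (t - δ) = Φ td := by
    rw [hφ]; dsimp only; rw [← htd, min_eq_left htdT]
  -- pointwise bound on `[0, t]`
  have hpt : ∀ τ ∈ Icc 0 t, ∀ x, (min (1 + ‖x‖) R) ^ 3 * ‖g τ x‖ ≤
      (A₀ + C_G * (1 + (ν * T₁) ^ (3 / 2 : ℝ)) * A₀ + n * (C₀ * C_K * L) * A₁ * (I₁ + J₁ * T₁)) +
        n * (C₀ * C_K * L) * I * Φ t + n * (C₀ * C_K * L) * (J * T₁) * Φ td := by
    intro τ hτ x
    have hw0 : 0 ≤ (min (1 + ‖x‖) R) ^ 3 := le_trans zero_le_one (decay_one_le_weight hR x)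
    have hrest : 0 ≤ C_G * (1 + (ν * T₁) ^ (3 / 2 : ℝ)) * A₀ + n * (C₀ * C_K * L) * A₁ * (I₁ + J₁ * T₁) +
        n * (C₀ * C_K * L) * I * Φ t + n * (C₀ * C_K * L) * (J * T₁) * Φ td := by positivity
    rcases hτ.1.eq_or_lt with hτ0 | hτpos
    · -- `τ = 0`
      rw [← hτ0]
      calc (min (1 + ‖x‖) R) ^ 3 * ‖g 0 x‖ ≤ (1 + ‖x‖) ^ 3 * ‖g 0 x‖ :=
            mul_le_mul_of_nonneg_right (decay_weight_le_cube R x) (norm_nonneg _)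
        _ ≤ A₀ := hg0 x
        _ ≤ _ := by linarith
    · -- `0 < τ`: the representation
      have hτT₁ : τ ≤ T₁ := hτ.2.trans ht.2
      have hτT : τ ∈ Ioc 0 T₁ := ⟨hτpos, hτT₁⟩
      have hντ : 0 < ν * τ := mul_pos hν hτpos
      -- the caloric term
      have hheat : (min (1 + ‖x‖) R) ^ 3 * ‖heatExtension (g 0) (ν * τ) x‖ ≤
          C_G * (1 + (ν * T₁) ^ (3 / 2 : ℝ)) * A₀ := by
        have h1 := hG hντ hg0c hg0 x
        have h2 : (ν * τ) ^ (3 / 2 : ℝ) ≤ (ν * T₁) ^ (3 / 2 : ℝ) :=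
          Real.rpow_le_rpow hντ.le (mul_le_mul_of_nonneg_left hτT₁ hν.le) (by norm_num)
        calc (min (1 + ‖x‖) R) ^ 3 * ‖heatExtension (g 0) (ν * τ) x‖
            ≤ (1 + ‖x‖) ^ 3 * ‖heatExtension (g 0) (ν * τ) x‖ :=
              mul_le_mul_of_nonneg_right (decay_weight_le_cube R x) (norm_nonneg _)
          _ ≤ C_G * (1 + (ν * τ) ^ (3 / 2 : ℝ)) * A₀ := h1
          _ ≤ C_G * (1 + (ν * T₁) ^ (3 / 2 : ℝ)) * A₀ := by gcongr
      -- each Duhamel term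
      set M : ℝ := C₀ * C_K * L * (I * Φ t + J * T₁ * Φ td) + C₀ * C_K * L * (A₁ * (I₁ + J₁ * T₁))
        with hM
      have hT0 : 0 ≤ C₀ * C_K * L * (I * Φ t + J * T₁ * Φ td) := by positivity
      have hT1 : 0 ≤ C₀ * C_K * L * (A₁ * (I₁ + J₁ * T₁)) := by positivity
      have hM0 : 0 ≤ M := add_nonneg hT0 hT1
      have hterm : ∀ i, (min (1 + ‖x‖) R) ^ 3 * ‖oseenDuhamel ν 0 (a i) (b i) τ x‖ ≤ M := by
        intro i
        obtain ⟨hbd, hcase⟩ := hlist i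
        -- case A: a component is `g`
        have hcaseA : (a i = g ∨ b i = g) →
            (min (1 + ‖x‖) R) ^ 3 * ‖oseenDuhamel ν 0 (a i) (b i) τ x‖ ≤
              C₀ * C_K * L * (I * Φ t + J * T₁ * Φ td) := by
          intro hg
          have habφ : ∀ σ ∈ Ioo 0 τ, ∀ y,
              (min (1 + ‖y‖) R) ^ 3 * (‖a i σ y‖ * ‖b i σ y‖) ≤ L * φ σ := by
            intro σ hσ y
            have hσT : σ ∈ Icc 0 T₁ := ⟨hσ.1.le, hσ.2.le.trans hτT₁⟩
            have hσφ : (min (1 + ‖y‖) R) ^ 3 * ‖g σ y‖ ≤ φ σ := by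
              have h := hΦ1 (t := σ) hσT.2 σ ⟨hσ.1.le, le_rfl⟩ y
              rw [hφ]; dsimp only
              rwa [max_eq_left hσ.1.le, min_eq_left hσT.2]
            have hwy : 0 ≤ (min (1 + ‖y‖) R) ^ 3 := le_trans zero_le_one (decay_one_le_weight hR y)
            rcases hg with h1 | h2
            · rw [h1]
              calc (min (1 + ‖y‖) R) ^ 3 * (‖g σ y‖ * ‖b i σ y‖)
                  = ‖b i σ y‖ * ((min (1 + ‖y‖) R) ^ 3 * ‖g σ y‖) := by ring
                _ ≤ L * φ σ := mul_le_mul (hbd σ hσT y).2 hσφ (by positivity) hL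
            · rw [h2]
              calc (min (1 + ‖y‖) R) ^ 3 * (‖a i σ y‖ * ‖g σ y‖)
                  = ‖a i σ y‖ * ((min (1 + ‖y‖) R) ^ 3 * ‖g σ y‖) := by ring
                _ ≤ L * φ σ := mul_le_mul (hbd σ hσT y).1 hσφ (by positivity) hL
          have h := decay_weighted_oseenDuhamel_le hC₀ hC_K hK hW hν hR hτpos hL φ hφ0 hφm habφ hδ x
          rw [← hI, ← hJ] at h
          refine h.trans ?_
          have hφτ : φ τ ≤ Φ t := hφt ▸ hφm hτ.2
          have hφτd : φ (τ - δ) ≤ Φ td := hφtd ▸ hφm (by linarith [hτ.2])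
          have h3 : φ τ * I ≤ I * Φ t := by
            rw [mul_comm]; exact mul_le_mul_of_nonneg_left hφτ hI0
          have h4 : φ (τ - δ) * J * τ ≤ J * T₁ * Φ td := by
            calc φ (τ - δ) * J * τ ≤ Φ td * J * T₁ :=
                  mul_le_mul (mul_le_mul_of_nonneg_right hφτd hJ0) hτT₁ hτpos.le (by positivity)
              _ = J * T₁ * Φ td := by ring
          have h5 : φ τ * I + φ (τ - δ) * J * τ ≤ I * Φ t + J * T₁ * Φ td := add_le_add h3 h4
          exact mul_le_mul_of_nonneg_left h5 hCL
        -- case B: a component has known decay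
        have hcaseB : ((∀ τ ∈ Icc 0 T₁, ∀ y, (1 + ‖y‖) ^ 3 * ‖a i τ y‖ ≤ A₁) ∨
            (∀ τ ∈ Icc 0 T₁, ∀ y, (1 + ‖y‖) ^ 3 * ‖b i τ y‖ ≤ A₁)) →
            (min (1 + ‖x‖) R) ^ 3 * ‖oseenDuhamel ν 0 (a i) (b i) τ x‖ ≤
              C₀ * C_K * L * (A₁ * (I₁ + J₁ * T₁)) := by
          intro hdec
          have habφ : ∀ σ ∈ Ioo 0 τ, ∀ y,
              (min (1 + ‖y‖) R) ^ 3 * (‖a i σ y‖ * ‖b i σ y‖) ≤ L * (fun _ : ℝ => A₁) σ := by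
            intro σ hσ y
            have hσT : σ ∈ Icc 0 T₁ := ⟨hσ.1.le, hσ.2.le.trans hτT₁⟩
            have hwy : (min (1 + ‖y‖) R) ^ 3 ≤ (1 + ‖y‖) ^ 3 := decay_weight_le_cube R y
            have hwy0 : 0 ≤ (min (1 + ‖y‖) R) ^ 3 := le_trans zero_le_one (decay_one_le_weight hR y)
            rcases hdec with h1 | h2
            · calc (min (1 + ‖y‖) R) ^ 3 * (‖a i σ y‖ * ‖b i σ y‖)
                  = ‖b i σ y‖ * ((min (1 + ‖y‖) R) ^ 3 * ‖a i σ y‖) := by ring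
                _ ≤ L * A₁ := by
                    refine mul_le_mul (hbd σ hσT y).2 ?_ (by positivity) hL
                    exact le_trans (mul_le_mul_of_nonneg_right hwy (norm_nonneg _)) (h1 σ hσT y)
            · calc (min (1 + ‖y‖) R) ^ 3 * (‖a i σ y‖ * ‖b i σ y‖)
                  = ‖a i σ y‖ * ((min (1 + ‖y‖) R) ^ 3 * ‖b i σ y‖) := by ring
                _ ≤ L * A₁ := by
                    refine mul_le_mul (hbd σ hσT y).1 ?_ (by positivity) hL
                    exact le_trans (mul_le_mul_of_nonneg_right hwy (norm_nonneg _)) (h2 σ hσT y)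
          have h := decay_weighted_oseenDuhamel_le hC₀ hC_K hK hW hν hR hτpos hL (fun _ : ℝ => A₁)
            (fun _ => hA₁) (fun _ _ _ => le_rfl) habφ hT₁ x
          rw [← hI₁, ← hJ₁] at h
          refine h.trans ?_
          have h3 : A₁ * J₁ * τ ≤ A₁ * J₁ * T₁ := mul_le_mul_of_nonneg_left hτT₁ (by positivity)
          have h4 : A₁ * I₁ + A₁ * J₁ * τ ≤ A₁ * (I₁ + J₁ * T₁) := by linarith
          exact mul_le_mul_of_nonneg_left h4 hCL
        rcases hcase with h1 | h2 | h3 | h4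
        · exact (hcaseA (Or.inl h1)).trans (le_add_of_nonneg_right hT1)
        · exact (hcaseA (Or.inr h2)).trans (le_add_of_nonneg_right hT1)
        · exact (hcaseB (Or.inl h3)).trans (le_add_of_nonneg_left hT0)
        · exact (hcaseB (Or.inr h4)).trans (le_add_of_nonneg_left hT0)
      -- sum over the terms
      have hsum : (min (1 + ‖x‖) R) ^ 3 * ‖∑ i, oseenDuhamel ν 0 (a i) (b i) τ x‖ ≤ n * M := by
        calc (min (1 + ‖x‖) R) ^ 3 * ‖∑ i, oseenDuhamel ν 0 (a i) (b i) τ x‖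
            ≤ (min (1 + ‖x‖) R) ^ 3 * ∑ i, ‖oseenDuhamel ν 0 (a i) (b i) τ x‖ :=
              mul_le_mul_of_nonneg_left (norm_sum_le _ _) hw0
          _ = ∑ i, (min (1 + ‖x‖) R) ^ 3 * ‖oseenDuhamel ν 0 (a i) (b i) τ x‖ := Finset.mul_sum _ _ _
          _ ≤ ∑ _i : ι, M := Finset.sum_le_sum fun i _ => hterm i
          _ = Fintype.card ι * M := by rw [Finset.sum_const, Finset.card_univ, nsmul_eq_mul]
          _ ≤ n * M := mul_le_mul_of_nonneg_right (by exact_mod_cast hcard) hM0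
      -- assemble
      have hrepτ := hrep τ hτT x
      calc (min (1 + ‖x‖) R) ^ 3 * ‖g τ x‖
          = (min (1 + ‖x‖) R) ^ 3 * ‖heatExtension (g 0) (ν * τ) x -
              ∑ i, oseenDuhamel ν 0 (a i) (b i) τ x‖ := by rw [hrepτ]
        _ ≤ (min (1 + ‖x‖) R) ^ 3 * (‖heatExtension (g 0) (ν * τ) x‖ +
              ‖∑ i, oseenDuhamel ν 0 (a i) (b i) τ x‖) :=
            mul_le_mul_of_nonneg_left (norm_sub_le _ _) hw0
        _ = (min (1 + ‖x‖) R) ^ 3 * ‖heatExtension (g 0) (ν * τ) x‖ +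
              (min (1 + ‖x‖) R) ^ 3 * ‖∑ i, oseenDuhamel ν 0 (a i) (b i) τ x‖ := by ring
        _ ≤ C_G * (1 + (ν * T₁) ^ (3 / 2 : ℝ)) * A₀ + n * M := add_le_add hheat hsum
        _ = (C_G * (1 + (ν * T₁) ^ (3 / 2 : ℝ)) * A₀ + n * (C₀ * C_K * L) * A₁ * (I₁ + J₁ * T₁)) +
              n * (C₀ * C_K * L) * I * Φ t + n * (C₀ * C_K * L) * (J * T₁) * Φ td := by
            rw [hM]; ring
        _ ≤ _ := by linarith
  -- take the supremum
  exact hΦ2 ht.1 hpt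

end Summit.NavierStokesRegularity.NavierStokesRegularity.Theorems.SlicedKelvinPlanarFluxAPriori

end
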